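import Literature.AlgebraicGeometry.Resolution.LogRegularResolutionGeneral
import Literature.Geometry.PolyhedralFans.LinkedRefinementFamilyHolds
import HarnessLib

/-!
# Kato 1994 (10.4), ATLAS form — PROOF of the named fact
# `Kato1994_logRegular_hasResolution_general`

`Literature/AlgebraicGeometry/Resolution/LogRegularResolutionGeneralHolds.lean`. K. Kato, *Toric
singularities*, Amer. J. Math. 116 (1994), (10.4) (with (9.8) = [KKMS] and (10.3)); W. Nizioł,
*Toric singularities: log-blow-ups and global resolutions* (2006), Thm. 5.8: **a quasi-compact,
locally Noetherian, logarithmically regular scheme with Zariski fs charts admits a resolution of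
singularities.** The tree's rendering `Kato1994_logRegular_hasResolution_general`
(`LogRegularAtlas.lean`: every scheme with a `LogRegularAtlas` satisfies `Scheme.HasResolution`)
is PROVED here by combining

* `Kato1994_logRegular_hasResolution_general_of_linkedRegularRefinementFamily`
  (`LogRegularResolutionGeneral.lean`: the scheme side — links between the charts, compatible
  chart ideals from a linked regular projective refinement, Kato (10.3) chart regularity,
  res-type-037's gluing `Kato1994_logRegular_hasResolution_general_of_charts`), and
* `Fan.linkedRegularRefinementFamily_holds` (`LinkedRefinementFamilyHolds.lean`: the fan side —
  [KempfEtAl1973] Ch. II §2 Thm. 11* for a linked family of rational fans, built on the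
  PolyhedralFans library of res-lit-3 / res-type-043 / res-type-037).

References: [Kato1994] (9.8), (10.3), (10.4); [Niziol2006] Thm. 5.8; [KempfEtAl1973] Ch. I §2
Thm. 11, Ch. II §2.
-/

noncomputable section

namespace Literature.AlgebraicGeometry.Resolution

universe u

/-- **Kato 1994, (10.4), atlas form — PROVED.** Every scheme carrying a log regular Zariski fs
atlas (`LogRegularAtlas`: finitely many Noetherian affine charts by finitely generated, saturated,
spanning `P_i ⊆ ℤ^{n_i}`, log regular at every prime, defining the same log structure on overlaps)
has a resolution of singularities. [cite: Kato1994, (10.4)] [cite: Niziol2006, Thm. 5.8] -/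
theorem Kato1994_logRegular_hasResolution_general_holds :
    Kato1994_logRegular_hasResolution_general.{u} :=
  Kato1994_logRegular_hasResolution_general_of_linkedRegularRefinementFamily
    Literature.Geometry.PolyhedralFans.Fan.linkedRegularRefinementFamily_holds

/-- **Kato 1994, (10.4), in the `LogAtlas` rendering** (`LogRegularScheme.lean`: a quasi-compact
scheme with a log regular `LogAtlas`) — PROVED via res-type-037's equivalence of the two
renderings (`Kato1994_logRegularScheme_hasResolution_of_general`, `LogRegularAtlasComparison.lean`).
[cite: Kato1994, (10.4)] [cite: Niziol2006, Thm. 5.8] -/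
theorem Kato1994_logRegularScheme_hasResolution_holds :
    Kato1994_logRegularScheme_hasResolution.{u} :=
  Kato1994_logRegularScheme_hasResolution_of_general Kato1994_logRegular_hasResolution_general_holds

end Literature.AlgebraicGeometry.Resolution
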